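import Literature.Computability.Cryptography.RegevBootstrap
import Literature.Computability.Cryptography.RegevStageKernelLaws
import Literature.Algebra.EuclideanLattices.IntegerMatrixInverseGS
import Literature.Algebra.EuclideanLattices.DiscreteGaussianInt
import Literature.Algebra.EuclideanLattices.LatticeProblemsProofs
import Literature.Probability.Distributions.IndepProductLaw
import HarnessLib

/-!
# Regev 2009, Lemma 3.2 — the bootstrapping sampler, fully discrete form

Topic `Computability/Cryptography` (LWE), grouping namespace `Regev2009`; sequel of
`RegevBootstrap.lean` (Lemma 3.2 in its printed, continuous form: a continuous Gaussian reduced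
modulo the parallelepiped). This file proves the form the finite-precision MACHINE realises
(Regev 2009, §2 footnote on precision, p. 11: "sampling from `D_{ℤⁿ,r}` to within negligible
distance and rounding"): draw `g ∈ ℤⁿ` from the product of `n` discrete Gaussians `D_{ℤ,s}` —
which IS the discrete Gaussian `D_{ℤⁿ,s}` — and round it off to the integer lattice
`L = L(B) ⊆ ℤⁿ` in the basis `B` by Babai's floor `x = ⌊g B⁻¹⌋ B`, computed EXACTLY with the
integer inverse `invMatrix B = det(B)²·B⁻¹` of `IntegerMatrixInverseGS.lean`
(`roundOffCoeffs`, `roundOff`). The law of `x` is within statistical distance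
`π(2√n·(d/s) + (d/s)²) + 2⁻ⁿ` of `D_{L,s}` read in integer coordinates, `d = ∑ᵢ ‖bᵢ‖`
(**`tvDist_indepLaw_map_roundOff_le`**) — Regev's bound and Regev's proof, with sums in place of
integrals: the fibre of the round-off over `x ∈ L` is `x + T`, `T = ℤⁿ ∩ P(B)` the integer points
of the parallelepiped (`roundOffRem`, `‖u‖ ≤ d` on `T`: `norm_le_of_mem_roundOffRem`), so by
Claim 2.1 the mass at `x` with `‖x‖ ≤ s√n` is `≥ (1 - π(2√n d/s + d²/s²))·|T|·ρ_s(x)/ρ_s(ℤⁿ)`, and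
`ρ_s(ℤⁿ) = ∑_{u ∈ T} ρ_s(L + u) ≤ |T|·ρ_s(L)` (the bijection `ℤⁿ × T ≃ ℤⁿ`, `(a, u) ↦ aB + u`:
`roundOffSplit`; `ρ_s(L + u) ≤ ρ_s(L)`: the tree's `tsum_gaussianFunction_sub_le`); the tail of
`D_{L,s}` outside the ball `‖x‖ < s√n` is `≤ 2⁻ⁿ` (Banaszczyk 1993, Lemma 1.5(i), the tree's
`Peikert2009.toOuterMeasure_discreteGaussian_norm_ge_le`), and
`PMF.tvDist_le_of_forall_mem_le` concludes. Everything here is proved; no named fact is introduced.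

Contents: `roundOffCoeffs`, `roundOff`, `roundOffRem` (definitions); `invMatrix_mul`
(`invMatrix B · B = det(B)²·1`, the other-sided companion of `GSInverse.mul_invMatrix`);
`roundOffCoeffs_vecMul_add`, `roundOff_vecMul_add`, `mem_roundOffRem_iff`,
`norm_le_of_mem_roundOffRem`, `roundOffRem_finite`, `roundOffSplit`; `coeffLatticeEquiv`
(`ℤⁿ ≃ L(B)` for a nonsingular `B`); `indepLaw_discreteGaussianInt_apply` (the product of `n`
copies of `D_{ℤ,s}` has mass `ρ_s(g)/ρ_s(ℤ)ⁿ` at `g`); the theorem.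

## References

* O. Regev, *On lattices, learning with errors, random linear codes, and cryptography*, J. ACM 56
  (2009), art. 34; author's version arXiv:2401.03703: Lemma 3.2 and its proof (p. 15), Claim 2.1
  (p. 11), Lemma 2.5 (p. 13), §2 footnote on finite precision (p. 11) [Regev2009].
* L. Babai, *On Lovász' lattice reduction and the nearest lattice point problem*, Combinatorica 6
  (1986), §3 (the round-off procedure) [Babai1986].
* W. Banaszczyk, *New bounds in some transference theorems in the geometry of numbers*, Math. Ann.
  296 (1993), Lemma 1.5(i) [Banaszczyk1993].
* H. Cohen, *A Course in Computational Algebraic Number Theory*, GTM 138, Springer 1993, §2.6.3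
  (exact inverse of an integer matrix) [Cohen1993].
-/

noncomputable section

open MeasureTheory Module Matrix Literature.Algebra.EuclideanLattices Literature.Probability.Distributions
open scoped ENNReal Real

namespace Literature.Computability.Cryptography

namespace Regev2009

variable {n : ℕ}

/-! ### Babai's round-off in exact integer arithmetic -/

/-- **The floor coefficients `⌊g B⁻¹⌋` of an integer vector `g` in the (row) basis `B`**, computed
exactly: `(g ᵥ* invMatrix B)ᵢ` floor-divided by `invDen = det(B)²` (`B⁻¹ = invMatrix B / det(B)²`).
[cite: Babai1986, §3; Cohen1993, §2.6.3] -/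
def roundOffCoeffs (B : Matrix (Fin n) (Fin n) ℤ) (g : Fin n → ℤ) : Fin n → ℤ :=
  fun i => (g ᵥ* GSInverse.invMatrix B) i / GSInverse.invDen (GSInverse.rowsOf B)

/-- **Babai's round-off `⌊g B⁻¹⌋ B ∈ L(B)`** of an integer vector `g`. [cite: Babai1986, §3; Regev2009, Lemma 3.2 (proof)] -/
def roundOff (B : Matrix (Fin n) (Fin n) ℤ) (g : Fin n → ℤ) : Fin n → ℤ :=
  roundOffCoeffs B g ᵥ* B

/-- **The integer points of the parallelepiped `P(B)`**: the vectors rounded off to `0`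
(`T = {u ∈ ℤⁿ | ⌊u B⁻¹⌋ = 0}`). [cite: Regev2009, Lemma 3.2 (proof)] -/
def roundOffRem (B : Matrix (Fin n) (Fin n) ℤ) : Set (Fin n → ℤ) :=
  {u | roundOffCoeffs B u = 0}

section RoundOff

variable {B : Matrix (Fin n) (Fin n) ℤ}

/-- `0 < invDen` for a nonsingular matrix. [cite: Cohen1993, §2.6.3] -/
theorem invDen_rowsOf_pos (hB : B.det ≠ 0) : 0 < GSInverse.invDen (GSInverse.rowsOf B) :=
  GSInverse.invDen_pos (GSInverse.isSquare_rowsOf B) (GSInverse.linearIndependent_realRows_rowsOf hB)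

/-- **`invMatrix B · B = det(B)² · I`** (the integer inverse is two-sided). [cite: Cohen1993, §2.6.3] -/
theorem invMatrix_mul (hB : B.det ≠ 0) :
    GSInverse.invMatrix B * B = (GSInverse.invDen (GSInverse.rowsOf B)) • (1 : Matrix (Fin n) (Fin n) ℤ) := by
  set D := GSInverse.invDen (GSInverse.rowsOf B) with hD
  set G := GSInverse.invMatrix B with hG
  have hBG : B * G = D • (1 : Matrix (Fin n) (Fin n) ℤ) := GSInverse.mul_invMatrix_eq_invDen hB
  have hD0 : (D : ℚ) ≠ 0 := by exact_mod_cast (invDen_rowsOf_pos hB).ne'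
  let f : ℤ →+* ℚ := Int.castRingHom ℚ
  have hone : (D • (1 : Matrix (Fin n) (Fin n) ℤ)).map ⇑f = (D : ℚ) • (1 : Matrix (Fin n) (Fin n) ℚ) := by
    ext i j
    simp only [Matrix.map_apply, Matrix.smul_apply, Matrix.one_apply, smul_eq_mul]
    split_ifs <;> simp [f]
  have h1 : B.map ⇑f * ((D : ℚ)⁻¹ • G.map ⇑f) = 1 := by
    rw [Matrix.mul_smul, ← Matrix.map_mul, hBG, hone, smul_smul, inv_mul_cancel₀ hD0, one_smul]
  have h2 : ((D : ℚ)⁻¹ • G.map ⇑f) * B.map ⇑f = 1 := mul_eq_one_comm.1 h1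
  have h3 : (G * B).map ⇑f = (D • (1 : Matrix (Fin n) (Fin n) ℤ)).map ⇑f := by
    rw [Matrix.map_mul, hone]
    rw [Matrix.smul_mul] at h2
    have h4 := congrArg (fun M : Matrix (Fin n) (Fin n) ℚ => (D : ℚ) • M) h2
    simp only [smul_smul, mul_inv_cancel₀ hD0, one_smul] at h4
    exact h4
  exact Matrix.map_injective (f := ⇑f) (fun a b h => by simpa [f] using h) h3

/-- `(a B) · invMatrix B = det(B)² a`. [cite: Cohen1993, §2.6.3] -/
theorem vecMul_vecMul_invMatrix (hB : B.det ≠ 0) (a : Fin n → ℤ) :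
    a ᵥ* B ᵥ* GSInverse.invMatrix B = GSInverse.invDen (GSInverse.rowsOf B) • a := by
  rw [Matrix.vecMul_vecMul, GSInverse.mul_invMatrix_eq_invDen hB, Matrix.vecMul_smul, Matrix.vecMul_one]

/-- `(u · invMatrix B) B = det(B)² u`. [cite: Cohen1993, §2.6.3] -/
theorem vecMul_invMatrix_vecMul (hB : B.det ≠ 0) (u : Fin n → ℤ) :
    u ᵥ* GSInverse.invMatrix B ᵥ* B = GSInverse.invDen (GSInverse.rowsOf B) • u := by
  rw [Matrix.vecMul_vecMul, invMatrix_mul hB, Matrix.vecMul_smul, Matrix.vecMul_one]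

/-- **Translation by a lattice vector shifts the floor coefficients**: `⌊(aB + u)B⁻¹⌋ = a + ⌊uB⁻¹⌋`.
[cite: Babai1986, §3] -/
theorem roundOffCoeffs_vecMul_add (hB : B.det ≠ 0) (a u : Fin n → ℤ) :
    roundOffCoeffs B (a ᵥ* B + u) = a + roundOffCoeffs B u := by
  funext i
  simp only [roundOffCoeffs, Matrix.add_vecMul, vecMul_vecMul_invMatrix hB, Pi.add_apply, Pi.smul_apply,
    smul_eq_mul]
  rw [add_comm (GSInverse.invDen (GSInverse.rowsOf B) * a i), Int.add_mul_ediv_left _ _ (invDen_rowsOf_pos hB).ne',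
    add_comm]

/-- `⌊0 · B⁻¹⌋ = 0`. [folklore] -/
@[simp] theorem roundOffCoeffs_zero (B : Matrix (Fin n) (Fin n) ℤ) : roundOffCoeffs B 0 = 0 := by
  funext i
  simp [roundOffCoeffs]

/-- A vector of `T` rounds off to `0`. [folklore] -/
theorem roundOff_eq_zero_of_mem {u : Fin n → ℤ} (hu : u ∈ roundOffRem B) : roundOff B u = 0 := by
  rw [roundOff, show roundOffCoeffs B u = 0 from hu, Matrix.zero_vecMul]

/-- **The fibres of the round-off**: `aB + u ↦ aB` for `u ∈ T`. [cite: Regev2009, Lemma 3.2 (proof)] -/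
theorem roundOff_vecMul_add (hB : B.det ≠ 0) (a : Fin n → ℤ) {u : Fin n → ℤ} (hu : u ∈ roundOffRem B) :
    roundOff B (a ᵥ* B + u) = a ᵥ* B := by
  rw [roundOff, roundOffCoeffs_vecMul_add hB, show roundOffCoeffs B u = 0 from hu, add_zero]

/-- Lattice vectors are fixed by the round-off. [cite: Babai1986, §3] -/
theorem roundOff_vecMul (hB : B.det ≠ 0) (a : Fin n → ℤ) : roundOff B (a ᵥ* B) = a ᵥ* B := by
  simpa using roundOff_vecMul_add hB a (u := 0) (by simp [roundOffRem])

/-- `g - roundOff g ∈ T`. [cite: Regev2009, Lemma 3.2 (proof)] -/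
theorem sub_roundOff_mem_roundOffRem (hB : B.det ≠ 0) (g : Fin n → ℤ) : g - roundOff B g ∈ roundOffRem B := by
  show roundOffCoeffs B (g - roundOff B g) = 0
  have h : g - roundOff B g = (-roundOffCoeffs B g) ᵥ* B + g := by
    rw [Matrix.neg_vecMul, roundOff]; abel
  rw [h, roundOffCoeffs_vecMul_add hB, neg_add_cancel]

/-- **`ℤⁿ = ⨆_{u ∈ T} (L(B) + u)`**: the bijection `ℤⁿ × T ≃ ℤⁿ`, `(a, u) ↦ aB + u`, with inverse
`g ↦ (⌊gB⁻¹⌋, g - roundOff g)`. [cite: Regev2009, Lemma 3.2 (proof)] -/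
def roundOffSplit (hB : B.det ≠ 0) : (Fin n → ℤ) × roundOffRem B ≃ (Fin n → ℤ) where
  toFun p := p.1 ᵥ* B + (p.2 : Fin n → ℤ)
  invFun g := (roundOffCoeffs B g, ⟨g - roundOff B g, sub_roundOff_mem_roundOffRem hB g⟩)
  left_inv p := by
    obtain ⟨a, u, hu⟩ := p
    have h1 : roundOffCoeffs B (a ᵥ* B + u) = a := by
      rw [roundOffCoeffs_vecMul_add hB, show roundOffCoeffs B u = 0 from hu, add_zero]
    refine Prod.ext h1 (Subtype.ext ?_)
    show a ᵥ* B + u - roundOff B (a ᵥ* B + u) = u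
    rw [roundOff_vecMul_add hB a hu, add_sub_cancel_left]
  right_inv g := by
    show roundOffCoeffs B g ᵥ* B + (g - roundOff B g) = g
    rw [roundOff, add_sub_cancel]

/-- **`T = ℤⁿ ∩ P(B)`**: `u ∈ T` iff every exact coordinate `(u·invMatrix B)ᵢ` lies in `[0, det(B)²)`,
i.e. `u B⁻¹ ∈ [0,1)ⁿ`. [cite: Regev2009, Lemma 3.2 (proof)] -/
theorem mem_roundOffRem_iff (hB : B.det ≠ 0) (u : Fin n → ℤ) :
    u ∈ roundOffRem B ↔ ∀ i, 0 ≤ (u ᵥ* GSInverse.invMatrix B) i ∧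
      (u ᵥ* GSInverse.invMatrix B) i < GSInverse.invDen (GSInverse.rowsOf B) := by
  have hD := invDen_rowsOf_pos hB
  rw [roundOffRem, Set.mem_setOf_eq, funext_iff]
  refine forall_congr' fun i => ⟨fun h => ?_, fun h => Int.ediv_eq_zero_of_lt h.1 h.2⟩
  have h0 : (u ᵥ* GSInverse.invMatrix B) i / GSInverse.invDen (GSInverse.rowsOf B) = 0 := h
  have he := Int.emod_add_mul_ediv ((u ᵥ* GSInverse.invMatrix B) i) (GSInverse.invDen (GSInverse.rowsOf B))
  rw [h0, mul_zero, add_zero] at he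
  exact ⟨he ▸ Int.emod_nonneg _ hD.ne', he ▸ Int.emod_lt_of_pos _ hD⟩

/-- **`‖u‖ ≤ ∑ᵢ ‖bᵢ‖` on `T`** (`u = ∑ tᵢbᵢ` with `tᵢ ∈ [0,1)`). [cite: Regev2009, Lemma 3.2 (proof: "a basis … of length at most …")] -/
theorem norm_le_of_mem_roundOffRem (hB : B.det ≠ 0) {u : Fin n → ℤ} (hu : u ∈ roundOffRem B) :
    ‖intVecToEuclidean n u‖ ≤ ∑ i, ‖intVecToEuclidean n (B i)‖ := by
  set D := GSInverse.invDen (GSInverse.rowsOf B) with hD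
  set w := u ᵥ* GSInverse.invMatrix B with hw
  have hDpos : 0 < D := invDen_rowsOf_pos hB
  have hDR : (0 : ℝ) < D := by exact_mod_cast hDpos
  have hwB : w ᵥ* B = D • u := vecMul_invMatrix_vecMul hB u
  -- `D • u = ∑ wᵢ bᵢ` in `ℝⁿ`
  have hsum : (D : ℝ) • intVecToEuclidean n u = ∑ i, (w i : ℝ) • intVecToEuclidean n (B i) := by
    have h1 : intVecToEuclidean n (w ᵥ* B) = ∑ i, w i • intVecToEuclidean n (B i) :=
      (⟨n, B⟩ : LatticeInstance).ofCoeffs_eq_sum w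
    rw [hwB, map_zsmul] at h1
    rw [← Int.cast_smul_eq_zsmul ℝ] at h1
    rw [h1]
    exact Finset.sum_congr rfl fun i _ => (Int.cast_smul_eq_zsmul ℝ (w i) _).symm
  have hwi : ∀ i, |(w i : ℝ)| ≤ D := by
    intro i
    obtain ⟨h0, h1⟩ := (mem_roundOffRem_iff hB u).1 hu i
    rw [abs_of_nonneg (by exact_mod_cast h0)]
    exact_mod_cast h1.le
  have key : (D : ℝ) * ‖intVecToEuclidean n u‖ ≤ D * ∑ i, ‖intVecToEuclidean n (B i)‖ := by
    calc (D : ℝ) * ‖intVecToEuclidean n u‖ = ‖(D : ℝ) • intVecToEuclidean n u‖ := by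
          rw [norm_smul, Real.norm_eq_abs, abs_of_pos hDR]
      _ = ‖∑ i, (w i : ℝ) • intVecToEuclidean n (B i)‖ := by rw [hsum]
      _ ≤ ∑ i, ‖(w i : ℝ) • intVecToEuclidean n (B i)‖ := norm_sum_le _ _
      _ ≤ ∑ i, D * ‖intVecToEuclidean n (B i)‖ := Finset.sum_le_sum fun i _ => by
          rw [norm_smul, Real.norm_eq_abs]
          exact mul_le_mul_of_nonneg_right (hwi i) (norm_nonneg _)
      _ = D * ∑ i, ‖intVecToEuclidean n (B i)‖ := (Finset.mul_sum _ _ _).symm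
  exact le_of_mul_le_mul_left key hDR

/-- **`T` is finite** (it lies in the box `|uⱼ| ≤ ⌈∑ᵢ ‖bᵢ‖⌉`). [folklore] -/
theorem roundOffRem_finite (hB : B.det ≠ 0) : (roundOffRem B).Finite := by
  set N : ℤ := ⌈∑ i, ‖intVecToEuclidean n (B i)‖⌉ with hN
  refine (Set.Finite.pi (ι := Fin n) (t := fun _ => Set.Icc (-N) N) fun _ => Set.finite_Icc _ _).subset ?_
  intro u hu
  simp only [Set.mem_pi, Set.mem_univ, Set.mem_Icc, forall_const]
  intro j
  have h1 : |(u j : ℝ)| ≤ ‖intVecToEuclidean n u‖ := by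
    have h := PiLp.norm_apply_le (intVecToEuclidean n u) j
    rwa [Real.norm_eq_abs] at h
  have h2 : |(u j : ℝ)| ≤ N := (h1.trans (norm_le_of_mem_roundOffRem hB hu)).trans (Int.le_ceil _)
  have h3 : |u j| ≤ N := by exact_mod_cast h2
  exact ⟨neg_le_of_abs_le h3, le_of_abs_le h3⟩

end RoundOff

/-! ### Integer coefficients ≃ lattice vectors -/

/-- **`ℤⁿ ≃ L(B)`, `a ↦ aB`**, for a nonsingular `B` generating the lattice of `I`.
[cite: MicciancioGoldwasser2002, Ch. 1 Def. 1.1] -/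
def coeffLatticeEquiv {I : LatticeInstance} (hI : I.IsNonsingular) (B : Matrix (Fin I.n) (Fin I.n) ℤ)
    (hL : (⟨I.n, B⟩ : LatticeInstance).lattice = I.lattice) : (Fin I.n → ℤ) ≃ I.lattice :=
  Equiv.ofBijective
    (fun a => ⟨(⟨I.n, B⟩ : LatticeInstance).ofCoeffs a, by
      rw [← hL]; exact (⟨I.n, B⟩ : LatticeInstance).ofCoeffs_mem_lattice a⟩)
    (by
      have hJ : (⟨I.n, B⟩ : LatticeInstance).IsNonsingular := LatticeInstance.isNonsingular_of_lattice_eq hI hL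
      refine ⟨fun a b h => ?_, fun v => ?_⟩
      · have h' : (⟨I.n, B⟩ : LatticeInstance).ofCoeffs (a - b) = 0 := by
          rw [ofCoeffs_sub, sub_eq_zero]; exact congrArg Subtype.val h
        exact sub_eq_zero.1 ((ofCoeffs_eq_zero_iff hJ _).1 h')
      · have hv : (v : EuclideanSpace ℝ (Fin I.n)) ∈ (⟨I.n, B⟩ : LatticeInstance).lattice := by
          rw [hL]; exact v.2
        obtain ⟨a, ha⟩ := ((⟨I.n, B⟩ : LatticeInstance).mem_lattice_iff _).1 hv
        exact ⟨a, Subtype.ext ha⟩)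

/-- The lattice vector of `a` is `aB` read in `ℝⁿ`. [folklore] -/
@[simp] theorem coe_coeffLatticeEquiv {I : LatticeInstance} (hI : I.IsNonsingular) (B : Matrix (Fin I.n) (Fin I.n) ℤ)
    (hL : (⟨I.n, B⟩ : LatticeInstance).lattice = I.lattice) (a : Fin I.n → ℤ) :
    ((coeffLatticeEquiv hI B hL a : I.lattice) : EuclideanSpace ℝ (Fin I.n)) = intVecToEuclidean I.n (a ᵥ* B) := rfl

/-! ### The product of `n` discrete Gaussians on `ℤ` is `D_{ℤⁿ,s}` -/

/-- **`∏ⱼ ρ_s(gⱼ) = ρ_s(g)`** for an integer vector `g`. [cite: Regev2009, §2 (eq. (5): `ρ_s` factors over coordinates)] -/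
theorem prod_gaussianFunction_intCast (s : ℝ) (g : Fin n → ℤ) :
    ∏ j, gaussianFunction s ((g j : ℤ) : ℝ) = gaussianFunction s (intVecToEuclidean n g) := by
  simp only [gaussianFunction]
  rw [← Real.exp_sum]
  congr 1
  have hn : ‖intVecToEuclidean n g‖ ^ 2 = ∑ j, ((g j : ℝ)) ^ 2 := by
    rw [norm_intVecToEuclidean, Real.sq_sqrt (Finset.sum_nonneg fun j _ => sq_nonneg _)]
  rw [hn]
  simp only [Real.norm_eq_abs, sq_abs]
  rw [Finset.mul_sum, Finset.sum_div]

/-- **Mass formula for the product law**: `(⨂ⱼ D_{ℤ,s})(g) = ρ_s(g) · ρ_s(ℤ)⁻ⁿ`.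
[cite: Regev2009, §2 (eq. (6) and the footnote on sampling `D_{ℤⁿ,r}` coordinatewise)] -/
theorem indepLaw_discreteGaussianInt_apply {s : ℝ} (hs : 0 < s) (g : Fin n → ℤ) :
    indepLaw n (fun _ => discreteGaussianInt s 0) g =
      ENNReal.ofReal (gaussianFunction s (intVecToEuclidean n g)) * ((gaussianMassInt s 0)⁻¹) ^ n := by
  rw [indepLaw_apply]
  simp only [discreteGaussianInt_apply hs, sub_zero]
  rw [Finset.prod_mul_distrib, Finset.prod_const, Finset.card_univ, Fintype.card_fin,
    ← ENNReal.ofReal_prod_of_nonneg fun j _ => (gaussianFunction_pos _ _).le, prod_gaussianFunction_intCast]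

/-! ### Lemma 3.2, discrete form -/

section Main

variable {I : LatticeInstance}

/-- **The pushforward of an injective read-out at a read value.** [folklore] -/
theorem map_apply_of_injective {α β : Type*} (p : PMF α) {f : α → β} (hf : Function.Injective f) (a : α) :
    p.map f (f a) = p a := by
  rw [PMF.map_apply, tsum_eq_single a]
  · rw [if_pos rfl]
  · intro a' ha'
    rw [if_neg fun h => ha' (hf h).symm]

/-- **Regev 2009, Lemma 3.2 — discrete distributional form.** For a nonsingular integer lattice
`L = L(I) ⊆ ℤⁿ`, a matrix `B` whose rows generate `L`, and `0 < s`: drawing `g` from the product of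
`n` discrete Gaussians `D_{ℤ,s}` and rounding off, `x = ⌊gB⁻¹⌋B`, gives a law within statistical
distance `π(2√n (d/s) + (d/s)²) + 2⁻ⁿ` of `D_{L,s}` (read in integer coordinates), `d = ∑ᵢ ‖bᵢ‖`.
[cite: Regev2009, Lemma 3.2 with Claim 2.1 and Lemma 2.5; Banaszczyk1993, Lemma 1.5(i)] -/
theorem tvDist_indepLaw_map_roundOff_le (hI : I.IsNonsingular) (B : Matrix (Fin I.n) (Fin I.n) ℤ)
    (hL : (⟨I.n, B⟩ : LatticeInstance).lattice = I.lattice) {s : ℝ} (hs : 0 < s) :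
    ((indepLaw I.n fun _ => discreteGaussianInt s 0).map (roundOff B)).tvDist
        ((discreteGaussian I.lattice s 0).map I.intCoords) ≤
      π * (2 * Real.sqrt I.n * ((∑ i, ‖intVecToEuclidean I.n (B i)‖) / s) +
        ((∑ i, ‖intVecToEuclidean I.n (B i)‖) / s) ^ 2) + 2⁻¹ ^ I.n := by
  classical
  haveI : IsZLattice ℝ I.lattice := LatticeInstance.isZLattice_of_isNonsingular hI
  set d : ℝ := ∑ i, ‖intVecToEuclidean I.n (B i)‖ with hd
  set c : ℝ := π * (2 * Real.sqrt I.n * (d / s) + (d / s) ^ 2) with hc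
  set μ : PMF (Fin I.n → ℤ) := indepLaw I.n fun _ => discreteGaussianInt s 0 with hμ
  set p : PMF (Fin I.n → ℤ) := μ.map (roundOff B) with hp
  set q : PMF (Fin I.n → ℤ) := (discreteGaussian I.lattice s 0).map I.intCoords with hq
  have hJ : (⟨I.n, B⟩ : LatticeInstance).IsNonsingular := LatticeInstance.isNonsingular_of_lattice_eq hI hL
  have hB : B.det ≠ 0 := hJ
  have hd0 : 0 ≤ d := Finset.sum_nonneg fun i _ => norm_nonneg _
  have hc0 : 0 ≤ c := by
    have : 0 ≤ d / s := div_nonneg hd0 hs.le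
    rw [hc]; positivity
  -- the trivial case `1 ≤ c`
  by_cases hc1 : 1 ≤ c
  · have h1 : p.tvDist q ≤ 1 := PMF.tvDist_le_one_holds p q
    have h2 : (0 : ℝ) ≤ 2⁻¹ ^ I.n := by positivity
    linarith
  rw [not_le] at hc1
  -- the finite set `T`
  have hTfin : (roundOffRem B).Finite := roundOffRem_finite hB
  haveI : Fintype (roundOffRem B) := hTfin.fintype
  set N : ℕ := Fintype.card (roundOffRem B) with hN
  -- Gaussian sums
  set ZL : ℝ := ∑' y : I.lattice, gaussianFunction s (y : EuclideanSpace ℝ (Fin I.n)) with hZL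
  have hZLpos : 0 < ZL := tsum_gaussianFunction_pos I.lattice hs
  set W : ℝ≥0∞ := ∑' g : Fin I.n → ℤ, ENNReal.ofReal (gaussianFunction s (intVecToEuclidean I.n g)) with hW
  -- the mass function of `μ`
  set K : ℝ≥0∞ := ((gaussianMassInt s 0)⁻¹) ^ I.n with hK
  have hμg : ∀ g, μ g = ENNReal.ofReal (gaussianFunction s (intVecToEuclidean I.n g)) * K := fun g =>
    indepLaw_discreteGaussianInt_apply hs g
  have hK0 : K ≠ 0 := pow_ne_zero _ (ENNReal.inv_ne_zero.2 (gaussianMassInt_ne_top hs.ne' 0))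
  have hWK : W * K = 1 := by
    rw [hW, ← ENNReal.tsum_mul_right]
    simp_rw [← hμg]
    exact μ.tsum_coe
  have hKW : K = W⁻¹ := ENNReal.eq_inv_of_mul_eq_one_left (by rw [mul_comm]; exact hWK)
  have hWtop : W ≠ ∞ := by
    intro h
    rw [h, ENNReal.top_mul hK0] at hWK
    exact ENNReal.top_ne_one hWK
  have hW0 : W ≠ 0 := by
    intro h
    rw [h, zero_mul] at hWK
    exact zero_ne_one hWK
  -- `W = ∑_{u ∈ T} ρ_s(L + u) ≤ N · ρ_s(L)`
  have hWle : W ≤ (N : ℝ≥0∞) * ENNReal.ofReal ZL := by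
    have e1 : W = ∑' pr : (Fin I.n → ℤ) × roundOffRem B,
        ENNReal.ofReal (gaussianFunction s (intVecToEuclidean I.n (pr.1 ᵥ* B + (pr.2 : Fin I.n → ℤ)))) := by
      rw [hW, ← (roundOffSplit hB).tsum_eq]; rfl
    have e2 : (∑' pr : (Fin I.n → ℤ) × roundOffRem B,
        ENNReal.ofReal (gaussianFunction s (intVecToEuclidean I.n (pr.1 ᵥ* B + (pr.2 : Fin I.n → ℤ))))) =
        ∑' (u : roundOffRem B) (a : Fin I.n → ℤ), ENNReal.ofReal (gaussianFunction s (intVecToEuclidean I.n (a ᵥ* B + (u : Fin I.n → ℤ)))) := by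
      exact (ENNReal.tsum_prod (f := fun (a : Fin I.n → ℤ) (u : roundOffRem B) =>
        ENNReal.ofReal (gaussianFunction s (intVecToEuclidean I.n (a ᵥ* B + (u : Fin I.n → ℤ)))))).trans ENNReal.tsum_comm
    have inner : ∀ u : roundOffRem B,
        (∑' a : Fin I.n → ℤ, ENNReal.ofReal (gaussianFunction s (intVecToEuclidean I.n (a ᵥ* B + (u : Fin I.n → ℤ))))) ≤ ENNReal.ofReal ZL := by
      intro u
      have e3 : (∑' a : Fin I.n → ℤ, ENNReal.ofReal (gaussianFunction s (intVecToEuclidean I.n (a ᵥ* B + (u : Fin I.n → ℤ))))) =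
          ∑' y : I.lattice, ENNReal.ofReal (gaussianFunction s ((y : EuclideanSpace ℝ (Fin I.n)) - (-intVecToEuclidean I.n (u : Fin I.n → ℤ)))) := by
        rw [← (coeffLatticeEquiv hI B hL).tsum_eq]
        refine tsum_congr fun a => ?_
        rw [coe_coeffLatticeEquiv, map_add, sub_neg_eq_add]
      rw [e3, ← ENNReal.ofReal_tsum_of_nonneg (fun y => (gaussianFunction_pos _ _).le)
        (summable_gaussianFunction_sub I.lattice hs.ne' _)]
      exact ENNReal.ofReal_le_ofReal (tsum_gaussianFunction_sub_le I.lattice hs _)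
    rw [e1, e2]
    calc (∑' (u : roundOffRem B) (a : Fin I.n → ℤ), ENNReal.ofReal (gaussianFunction s (intVecToEuclidean I.n (a ᵥ* B + (u : Fin I.n → ℤ)))))
          ≤ ∑' _u : roundOffRem B, ENNReal.ofReal ZL := ENNReal.tsum_le_tsum inner
      _ = (N : ℝ≥0∞) * ENNReal.ofReal ZL := by
          rw [tsum_fintype (L := SummationFilter.unconditional _), Finset.sum_const, Finset.card_univ, hN, nsmul_eq_mul]
  have hWreal : W.toReal ≤ N * ZL := by
    have h := ENNReal.toReal_mono (ENNReal.mul_ne_top (ENNReal.natCast_ne_top N) ENNReal.ofReal_ne_top) hWle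
    rwa [ENNReal.toReal_mul, ENNReal.toReal_natCast, ENNReal.toReal_ofReal hZLpos.le] at h
  have hWrpos : 0 < W.toReal := ENNReal.toReal_pos hW0 hWtop
  -- domination on the ball
  set S : Set (Fin I.n → ℤ) := {x | ∃ v : I.lattice, I.intCoords v = x ∧ ‖(v : EuclideanSpace ℝ (Fin I.n))‖ < s * Real.sqrt I.n} with hS
  have hdom : ∀ x ∈ S, (1 - c) * (q x).toReal ≤ (p x).toReal := by
    rintro x ⟨v, hvx, hvn⟩
    -- `x = aB`, `v = ι x`
    have hιx : intVecToEuclidean I.n x = (v : EuclideanSpace ℝ (Fin I.n)) := by rw [← hvx]; exact LatticeInstance.intVecToEuclidean_intCoords I v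
    set a := (coeffLatticeEquiv hI B hL).symm v with ha
    have hax : a ᵥ* B = x := by
      apply intVecToEuclidean_injective I.n
      have h := coe_coeffLatticeEquiv hI B hL a
      rw [ha, Equiv.apply_symm_apply] at h
      rw [hιx]; exact h.symm
    -- `q x = D_{L,s}(v)`
    have hqx : (q x).toReal = gaussianFunction s (v : EuclideanSpace ℝ (Fin I.n)) / ZL := by
      rw [hq, ← hvx, map_apply_of_injective _ (LatticeInstance.intCoords_injective I), toReal_discreteGaussian_eq I.lattice hs]
    -- `p x ≥ ∑_{u ∈ T} μ (x + u)`
    have hpx : (∑ u : roundOffRem B, μ (x + (u : Fin I.n → ℤ))) ≤ p x := by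
      rw [hp, PMF.map_apply, ← tsum_fintype (L := SummationFilter.unconditional _)]
      have hinj : Function.Injective fun u : roundOffRem B => x + (u : Fin I.n → ℤ) :=
        fun u u' h => Subtype.ext (add_left_cancel h)
      refine le_trans (le_of_eq ?_) (ENNReal.tsum_comp_le_tsum_of_injective hinj _)
      refine tsum_congr fun u => ?_
      have hru : x = roundOff B (x + (u : Fin I.n → ℤ)) := by rw [← hax, roundOff_vecMul_add hB a u.2]
      simp only [← hru, if_true]
    have hpx' : (∑ u : roundOffRem B, (μ (x + (u : Fin I.n → ℤ))).toReal) ≤ (p x).toReal := by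
      rw [← ENNReal.toReal_sum fun u _ => PMF.apply_ne_top _ _]
      exact ENNReal.toReal_mono (PMF.apply_ne_top _ _) hpx
    -- each term: Claim 2.1
    have hterm : ∀ u : roundOffRem B,
        (1 - c) * gaussianFunction s (v : EuclideanSpace ℝ (Fin I.n)) * (W⁻¹).toReal ≤ (μ (x + (u : Fin I.n → ℤ))).toReal := by
      intro u
      rw [hμg, hKW, ENNReal.toReal_mul, ENNReal.toReal_ofReal (gaussianFunction_pos _ _).le]
      refine mul_le_mul_of_nonneg_right ?_ ENNReal.toReal_nonneg
      have h21 := gaussianFunction_ge_of_norm_le (s := s) (t := s * Real.sqrt I.n) (l := d) (x := (v : EuclideanSpace ℝ (Fin I.n)))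
        (y := intVecToEuclidean I.n (x + (u : Fin I.n → ℤ))) hd0 hvn.le (by
          rw [map_add, hιx, add_sub_cancel_left]
          exact norm_le_of_mem_roundOffRem hB u.2)
      have hcc : 1 - π * (2 * d * (s * Real.sqrt I.n) + d ^ 2) / s ^ 2 = 1 - c := by
        rw [hc]; field_simp
      rw [hcc] at h21
      exact h21
    have hsum : (N : ℝ) * ((1 - c) * gaussianFunction s (v : EuclideanSpace ℝ (Fin I.n)) * (W⁻¹).toReal) ≤ (p x).toReal := by
      refine le_trans ?_ hpx'
      rw [show (N : ℝ) * ((1 - c) * gaussianFunction s (v : EuclideanSpace ℝ (Fin I.n)) * (W⁻¹).toReal) =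
          ∑ _u : roundOffRem B, (1 - c) * gaussianFunction s (v : EuclideanSpace ℝ (Fin I.n)) * (W⁻¹).toReal by
        rw [Finset.sum_const, Finset.card_univ, hN, nsmul_eq_mul]]
      exact Finset.sum_le_sum fun u _ => hterm u
    -- `N / W ≥ 1 / ZL`
    have hNW : 1 / ZL ≤ (N : ℝ) * (W⁻¹).toReal := by
      rw [ENNReal.toReal_inv, ← div_eq_mul_inv, div_le_div_iff₀ hZLpos hWrpos, one_mul]
      exact hWreal
    have hρ0 : 0 ≤ (1 - c) * gaussianFunction s (v : EuclideanSpace ℝ (Fin I.n)) := mul_nonneg (by linarith) (gaussianFunction_pos _ _).le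
    calc (1 - c) * (q x).toReal = (1 - c) * gaussianFunction s (v : EuclideanSpace ℝ (Fin I.n)) * (1 / ZL) := by rw [hqx]; ring
      _ ≤ (1 - c) * gaussianFunction s (v : EuclideanSpace ℝ (Fin I.n)) * ((N : ℝ) * (W⁻¹).toReal) := mul_le_mul_of_nonneg_left hNW hρ0
      _ = (N : ℝ) * ((1 - c) * gaussianFunction s (v : EuclideanSpace ℝ (Fin I.n)) * (W⁻¹).toReal) := by ring
      _ ≤ (p x).toReal := hsum
  have htv := PMF.tvDist_le_of_forall_mem_le p q S hc0 hdom
  refine htv.trans (add_le_add le_rfl ?_)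
  -- the tail of `D_{L,s}` outside the ball
  have hpre : I.intCoords ⁻¹' Sᶜ ⊆ {v : I.lattice | s * Real.sqrt (finrank ℝ (EuclideanSpace ℝ (Fin I.n))) ≤ ‖(v : EuclideanSpace ℝ (Fin I.n))‖} := by
    intro v hv
    simp only [Set.mem_preimage, Set.mem_compl_iff, hS, Set.mem_setOf_eq, not_exists, not_and, not_lt] at hv
    have h := hv v rfl
    simp only [Set.mem_setOf_eq, finrank_euclideanSpace_fin]
    exact h
  have htail := Peikert2009.toOuterMeasure_discreteGaussian_norm_ge_le I.lattice hs
  have hne : ((2⁻¹ : ℝ≥0∞) ^ finrank ℝ (EuclideanSpace ℝ (Fin I.n))) ≠ ∞ := ENNReal.pow_ne_top (by simp)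
  rw [hq, PMF.toOuterMeasure_map_apply]
  calc ((discreteGaussian I.lattice s 0).toOuterMeasure (I.intCoords ⁻¹' Sᶜ)).toReal
      ≤ ((2⁻¹ : ℝ≥0∞) ^ finrank ℝ (EuclideanSpace ℝ (Fin I.n))).toReal :=
        ENNReal.toReal_mono hne (((discreteGaussian I.lattice s 0).toOuterMeasure.mono hpre).trans htail)
    _ = 2⁻¹ ^ I.n := by
        rw [ENNReal.toReal_pow, ENNReal.toReal_inv, ENNReal.toReal_ofNat, finrank_euclideanSpace_fin]

end Main

end Regev2009

end Literature.Computability.Cryptography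

end
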